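import Summits.NavierStokesRegularity.NavierStokesRegularity.Theorems.ScenarioCensusScrewBlowdownBridges
import HarnessLib

/-!
# LINE «screw-blowdown» port, part 4/13: v1.4 axial recurrence — `IsAxiallyRecurrent`, `Row_ArecT`, `hasVanishingBlowdown_of_axiallyRecurrent`

Re-homed for the scenario census (typer seat ns-census-typer-1 g7; lead g9 RULINGS [7] 20:33Z / [8] 21:03Z / [12](b) 21:58Z: «screw-blowdown v1.8 =
version of record; `Row_A13isqT` DECIDED IN KERNEL → CANDIDATE-DECIDED member under A13 (row already TREE); typer-1 slot 3 port of record =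
`ScrewBlowdown_port_v1_8.lean` bb5f719a8be448dd (stub-free)»; lead g10 RULINGS [1](b) 22:36Z / [2] 22:42Z: «port v1.9 ffe1ad3d1d25e376 = port of record (idea-crit-3 DIFF-CHECK 22:40:40Z CONFORMS); slot 4 = its S3
appendix ADMISSIBLE after slot 3»; ref PRE-CHECKs items 13 / 15 / 20 / 27): VERBATIM PORT of ns-idea-4 LINE g12-1 «screw-blowdown» PORT copy
`pub/ideators/ns-idea-4/lines/screw-blowdown/port/ScrewBlowdown_port_v1_9.lean` sha16 ffe1ad3d1d25e376 (2890 l.; lean check rc 0, 0 sorry; = the v1.8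
port copy bb5f719a8be448dd as a literal prefix — itself the v1.7 copy 674e939b7b0b34e8 + the `LocalPersistence` attack appendix `…LP` + the consequences
`localPersistence_holds` / `farPastSpreading_holds` / `linearConeLiouville_holds` / `row_A13isqT_proved` — plus the v1.9 S3 block: `vanishingBlowdownLiouville_holds`,
`row_ArecT_proved`; parts 1–3 landed while v1.8 was the copy of record, text identical),
split for the 400-line rule into `ScenarioCensusScrewBlowdown` (§1–§3: objects, the cell `Row_A13isqT`, obligation Props, S1 PROVED) →
`…Plumbing` (§4, S2 PROVED) → `…Bridges` (§5 + v1.3) → `…Recurrent` (v1.4, `Row_ArecT`) → `…OffAxis` (v1.5 a) → `…Cone` (v1.5 b: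
`farPast_linearCone_smallness_of_screw`) → `…Residual` (v1.5 c + v1.6: `LinearConeLiouville`, DSS rungs) → `…Propagation` (v1.7: FS, LP,
reductions; the three class-general tools are NOT re-declared — taken BY NAME, general `E`, from `Theorems/TypeIAncientMildForwardUniqueness.lean`,
ns-idea-4 extract a1b589f6dec7da83, p671177) → `…LPTools` / `…LPDuhamel` / `…LP` (the appendix: Gaussian locality, the three-term Oseen split,
time weights; `duhamel_bound`; the bootstrap `one_step` / `persist` / `localPersistence` + the consequences incl. `row_A13isqT_proved`) →
`…Vanishing` (v1.9: S3 proved, `row_ArecT_proved`) → `…Keys` (census keys `Row_A13isqT` / `Row_ArecT` + `_excluded`).  Lean text VERBATIM in namespaces `…Theorems.ScenarioCensus.ScrewBlowdown` / `…ScrewBlowdownLP` (the line's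
`…Lines.ScrewBlowdownPort` / `…PortLP` re-homed; qualified references renamed accordingly); port edits: `local notation "E3"` → `abbrev E3` (the
appendix `open`s it), `@[conjecture]` on `VanishingBlowdownLiouville` only (part 1 landed while S3 was open; an obligation node, now with the closed
witness `vanishingBlowdownLiouville_holds`), seven one-line docstrings added, `continuous_rotZ_angle'` not re-declared (it restates the tree's
`Literature.Analysis.FluidPDE.continuous_rotZ_angle`, gate lint `dedup.landed`; its uses renamed), the line's `set_option linter.unusedVariables false` dropped (five proof lambdas
bind the unused `θ₀ h` as `_ _`; the unused hypothesis binders of `hasVanishingBlowdown_of_axiallyRecurrent` / `pointwise_small_of_zoom_small` are spelled `_hu` / `_hΛ`,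
statements otherwise identical); `set_option maxHeartbeats … in` of the appendix kept as in the line.

No census VALUE is moved by this file (row A13 is TREE already; the lead books the member A13isq-T); NS regularity is NOT proved; (L′)
`SymmetryModuliCount.TypeIAncientLiouville` is untouched (hypothesis of bridges only); no summit statement is proved by this file.
-/

-- the summit and its single problem share the name `NavierStokesRegularity` (D-0017 nested layout)
set_option linter.dupNamespace false

namespace Summit.NavierStokesRegularity.NavierStokesRegularity.Theorems.ScenarioCensus.ScrewBlowdown

open Set Function Filter Topology
open Literature.Analysis Literature.Analysis.FluidPDE
open Summit.NavierStokesRegularity.NavierStokesRegularity.Theorems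

/-! ### v1.4 — the lever's maximal domain: AXIAL RECURRENCE modulo rotations in the Type-I gauge (additive)

The blow-down argument never uses that the screw is an EXACT symmetry — only that `u` RETURNS, with axial shifts of
bounded gaps, near every rotated axial translate of itself, the defect being small in the scale-invariant gauge
`√(−t)‖·‖`.  This section types that hypothesis (`IsAxiallyRecurrent`), PROVES vanishing blow-down for the whole
recurrence class (`hasVanishingBlowdown_of_axiallyRecurrent`, sorry-free), shows the irrational screw is a member
(`isAxiallyRecurrent_of_screw`, via S1 and integer screw powers), and records the larger proposed cell
`Row_ArecT ⇐ VanishingBlowdownLiouville` (same residual S3).  Members of the class: `z`-periodic axisymmetric and helical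
fields (census A13/A8t, in tree), rational and irrational screws, and axially quasi-periodic Type-I fields modulo rotations
(new).  NB a pure axial return WITHOUT the rotation would not contain the irrational screw (a small rotation is not
sup-small far from the axis) — the rotation in the defect is essential.  Nothing of record is proved. -/

/-- **Axial recurrence modulo rotations in the Type-I gauge.**  For every tolerance `δ > 0` there is a gap bound `ℓ > 0`
such that for every target angle `φ` every axial window `[a, a + ℓ]` contains a shift `s` with an angle `ψ`, `|ψ − φ| ≤ δ`,
for which `(R_ψ, s e₃)` is a `δ`-symmetry of `u` in the scale-invariant gauge:
`‖u(t, R_ψ x + s e₃) − R_ψ u(t, x)‖ ≤ δ/√(−t)` for all `t < 0`, `x`. -/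
def IsAxiallyRecurrent (u : ℝ → E3 → E3) : Prop :=
  ∀ δ > (0 : ℝ), ∃ ℓ > (0 : ℝ), ∀ φ a : ℝ, ∃ s ∈ Icc a (a + ℓ), ∃ ψ : ℝ, |ψ - φ| ≤ δ ∧
    ∀ t < (0 : ℝ), ∀ x : E3, ‖u t (rotZ ψ x + s • eZ) - rotZ ψ (u t x)‖ ≤ δ / Real.sqrt (-t)

/-- Proposed larger cell (block A): an axially recurrent KNSS-gauge Type-I ancient mild field vanishes. -/
def Row_ArecT : Prop :=
  ∀ (C : ℝ) (u : ℝ → E3 → E3), IsTypeIAncientMild C u → IsAxiallyRecurrent u → ∀ t < (0 : ℝ), ∀ x, u t x = 0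

/-- The defect is scale-invariant: a `δ`-symmetry `(R_ψ, s e₃)` of `u` is a `δ`-symmetry `(R_ψ, (s/μ) e₃)` of the zoom. -/
theorem recurrence_defect_nsRescale {u : ℝ → E3 → E3} {μ δ ψ s : ℝ} (hμ : 0 < μ)
    (h : ∀ t < (0 : ℝ), ∀ x : E3, ‖u t (rotZ ψ x + s • eZ) - rotZ ψ (u t x)‖ ≤ δ / Real.sqrt (-t))
    {t : ℝ} (ht : t < 0) (x : E3) :
    ‖nsRescale μ u t (rotZ ψ x + (s / μ) • eZ) - rotZ ψ (nsRescale μ u t x)‖ ≤ δ / Real.sqrt (-t) := by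
  have ht' : μ ^ 2 * t < 0 := mul_neg_of_pos_of_neg (by positivity) ht
  have key := h (μ ^ 2 * t) ht' (μ • x)
  have hsq : Real.sqrt (-(μ ^ 2 * t)) = μ * Real.sqrt (-t) := by
    rw [show -(μ ^ 2 * t) = μ ^ 2 * (-t) by ring, Real.sqrt_mul (sq_nonneg μ), Real.sqrt_sq hμ.le]
  have hst : 0 < Real.sqrt (-t) := Real.sqrt_pos.2 (by linarith)
  simp only [nsRescale]
  have e1 : μ • (rotZ ψ x + (s / μ) • eZ) = rotZ ψ (μ • x) + s • eZ := by
    rw [smul_add, smul_smul, mul_div_cancel₀ _ hμ.ne', rotZ_smul]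
  rw [e1, rotZ_smul ψ μ (u (μ ^ 2 * t) (μ • x)), ← smul_sub, norm_smul, Real.norm_eq_abs, abs_of_pos hμ]
  calc μ * ‖u (μ ^ 2 * t) (rotZ ψ (μ • x) + s • eZ) - rotZ ψ (u (μ ^ 2 * t) (μ • x))‖
      ≤ μ * (δ / Real.sqrt (-(μ ^ 2 * t))) := mul_le_mul_of_nonneg_left key hμ.le
    _ = δ / Real.sqrt (-t) := by rw [hsq]; field_simp

/-- Step 1 on the recurrence class: the blow-down limit is `δ`-equivariant under `(R_a, s e₃)` for some angle `a`
within `δ` of the target. -/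
theorem approx_cylinder_invariance_rec {C : ℝ} {u W : ℝ → E3 → E3} (hR : IsAxiallyRecurrent u)
    (hW : IsTypeIAncientMild C W) {μ : ℕ → ℝ} (hμ : ∀ k, 0 < μ k) (hμ' : Tendsto μ atTop atTop)
    (hconv : ∀ t < (0 : ℝ), TendstoLocallyUniformly (fun k => nsRescale (μ k) u t) (W t) atTop)
    (s φ : ℝ) {t : ℝ} (ht : t < 0) (x : E3) {δ : ℝ} (hδ : 0 < δ) :
    ∃ a : ℝ, |a - φ| ≤ δ ∧ ‖W t (rotZ a x + s • eZ) - rotZ a (W t x)‖ ≤ δ / Real.sqrt (-t) := by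
  obtain ⟨ℓ, hℓ, hwin⟩ := hR δ hδ
  have hchoice : ∀ k : ℕ, ∃ sk ∈ Icc (s * μ k) (s * μ k + ℓ), ∃ ψ : ℝ, |ψ - φ| ≤ δ ∧
      ∀ t < (0 : ℝ), ∀ x : E3, ‖u t (rotZ ψ x + sk • eZ) - rotZ ψ (u t x)‖ ≤ δ / Real.sqrt (-t) :=
    fun k => hwin φ (s * μ k)
  choose sk hsk ψk hψk hdef using hchoice
  have hEq : ∀ k, ‖nsRescale (μ k) u t (rotZ (ψk k) x + (sk k / μ k) • eZ) -
      rotZ (ψk k) (nsRescale (μ k) u t x)‖ ≤ δ / Real.sqrt (-t) :=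
    fun k => recurrence_defect_nsRescale (hμ k) (hdef k) ht x
  -- the angles stay in the window: convergent subsequence
  have hbd : ∀ k, ψk k ∈ Icc (φ - δ) (φ + δ) := fun k => by
    have hk := hψk k
    rw [abs_le] at hk
    constructor <;> linarith [hk.1, hk.2]
  obtain ⟨a, ha, κ, hκ, hψa⟩ := tendsto_subseq_of_bounded (Metric.isBounded_Icc (φ - δ) (φ + δ)) hbd
  rw [closure_Icc] at ha
  refine ⟨a, by rw [abs_le]; constructor <;> linarith [ha.1, ha.2], ?_⟩
  -- the rescaled shifts converge to `s`
  have hsk_lim : Tendsto (fun k => sk k / μ k) atTop (𝓝 s) := by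
    have h1 : Tendsto (fun k => ℓ / μ k) atTop (𝓝 0) := tendsto_const_nhds.div_atTop hμ'
    rw [tendsto_iff_norm_sub_tendsto_zero]
    refine squeeze_zero (fun k => norm_nonneg _) (fun k => ?_) h1
    rw [Real.norm_eq_abs]
    have hk := hsk k
    have hμk := hμ k
    have e : sk k / μ k - s = (sk k - s * μ k) / μ k := by field_simp
    rw [e, abs_div, abs_of_pos hμk]
    apply div_le_div_of_nonneg_right _ hμk.le
    rw [abs_le]
    constructor <;> linarith [hk.1, hk.2]
  -- pass to the limit along `κ`
  have hcontW : Continuous (W t) := hW.continuous_slice ht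
  have hsub : TendstoLocallyUniformly (fun i => nsRescale (μ (κ i)) u t) (W t) atTop :=
    tendstoLocallyUniformly_subseq (hconv t ht) hκ
  have hψa' : Tendsto (fun i => ψk (κ i)) atTop (𝓝 a) := hψa
  have hy : Tendsto (fun i => rotZ (ψk (κ i)) x + (sk (κ i) / μ (κ i)) • eZ) atTop (𝓝 (rotZ a x + s • eZ)) :=
    (((continuous_rotZ_angle x).tendsto a).comp hψa').add ((hsk_lim.comp hκ.tendsto_atTop).smul_const eZ)
  have hL : Tendsto (fun i => nsRescale (μ (κ i)) u t (rotZ (ψk (κ i)) x + (sk (κ i) / μ (κ i)) • eZ)) atTop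
      (𝓝 (W t (rotZ a x + s • eZ))) :=
    hsub.tendsto_comp hcontW.continuousAt hy
  have hxx : Tendsto (fun _ : ℕ => x) atTop (𝓝 x) := tendsto_const_nhds
  have hpt : Tendsto (fun i => nsRescale (μ (κ i)) u t x) atTop (𝓝 (W t x)) :=
    TendstoLocallyUniformly.tendsto_comp (g := fun _ : ℕ => x) hsub hcontW.continuousAt hxx
  have hRot : Tendsto (fun i => rotZ (ψk (κ i)) (nsRescale (μ (κ i)) u t x)) atTop (𝓝 (rotZ a (W t x))) :=
    tendsto_rotZ_of_tendsto hψa' hpt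
  have hnorm := (hL.sub hRot).norm
  exact le_of_tendsto' hnorm fun i => hEq (κ i)

/-- Step 2 on the recurrence class: exact cylinder equivariance of every blow-down limit (`δ → 0`). -/
theorem cylinder_invariance_rec {C : ℝ} {u W : ℝ → E3 → E3} (hR : IsAxiallyRecurrent u)
    (hW : IsTypeIAncientMild C W) {μ : ℕ → ℝ} (hμ : ∀ k, 0 < μ k) (hμ' : Tendsto μ atTop atTop)
    (hconv : ∀ t < (0 : ℝ), TendstoLocallyUniformly (fun k => nsRescale (μ k) u t) (W t) atTop)
    (φ s : ℝ) {t : ℝ} (ht : t < 0) (x : E3) :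
    W t (rotZ φ x + s • eZ) = rotZ φ (W t x) := by
  have hA : ∀ i : ℕ, ∃ a : ℝ, |a - φ| ≤ 1 / ((i : ℝ) + 1) ∧
      ‖W t (rotZ a x + s • eZ) - rotZ a (W t x)‖ ≤ (1 / ((i : ℝ) + 1)) / Real.sqrt (-t) :=
    fun i => approx_cylinder_invariance_rec hR hW hμ hμ' hconv s φ ht x (by positivity)
  choose a ha using hA
  have hlim : Tendsto a atTop (𝓝 φ) := by
    rw [tendsto_iff_norm_sub_tendsto_zero]
    exact squeeze_zero (fun i => norm_nonneg _) (fun i => by rw [Real.norm_eq_abs]; exact (ha i).1)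
      tendsto_one_div_add_atTop_nhds_zero_nat
  have hcontW : Continuous (W t) := hW.continuous_slice ht
  have hL : Tendsto (fun i => W t (rotZ (a i) x + s • eZ)) atTop (𝓝 (W t (rotZ φ x + s • eZ))) :=
    (hcontW.tendsto _).comp ((((continuous_rotZ_angle x).tendsto φ).comp hlim).add tendsto_const_nhds)
  have hRot : Tendsto (fun i => rotZ (a i) (W t x)) atTop (𝓝 (rotZ φ (W t x))) :=
    ((continuous_rotZ_angle (W t x)).tendsto φ).comp hlim
  have hnorm := (hL.sub hRot).norm
  have hzero : Tendsto (fun i : ℕ => (1 / ((i : ℝ) + 1)) / Real.sqrt (-t)) atTop (𝓝 0) := by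
    simpa using tendsto_one_div_add_atTop_nhds_zero_nat.div_const (Real.sqrt (-t))
  have hle : ‖W t (rotZ φ x + s • eZ) - rotZ φ (W t x)‖ ≤ 0 :=
    le_of_tendsto_of_tendsto' hnorm hzero fun i => (ha i).2
  exact sub_eq_zero.1 (norm_le_zero_iff.1 hle)

/-- **Vanishing blow-down on the whole recurrence class (v1.4, PROVED).**  Every blow-down limit of an axially
recurrent KNSS-gauge Type-I ancient mild field is cylinder-invariant, hence zero. -/
theorem hasVanishingBlowdown_of_axiallyRecurrent {C : ℝ} {u : ℝ → E3 → E3} (_hu : IsTypeIAncientMild C u)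
    (hR : IsAxiallyRecurrent u) : HasVanishingBlowdown C u := by
  rintro W ⟨hW, μ, hμ, hμ', hconv⟩
  exact cylinderInvariant_eq_zero hW fun φ s t ht x => cylinder_invariance_rec hR hW hμ hμ' hconv φ s ht x

/-- The irrational screw with POSITIVE drift is axially recurrent (S1 + integer screw powers; defect `0`). -/
theorem isAxiallyRecurrent_of_screw_pos (h1 : SyndeticReturn) {u : ℝ → E3 → E3} {θ₀ h : ℝ}
    (hθ : Irrational (θ₀ / (2 * Real.pi))) (hh : 0 < h) (hS : IsScrewEquivariant θ₀ h u) :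
    IsAxiallyRecurrent u := by
  intro δ hδ
  obtain ⟨N, hN, hwin⟩ := h1 θ₀ hθ δ hδ
  refine ⟨((N : ℝ) + 1) * h, by positivity, fun φ a => ?_⟩
  obtain ⟨n, hmn, hnm, k, hk⟩ := hwin φ ⌈a / h⌉
  refine ⟨(n : ℝ) * h, ⟨?_, ?_⟩, (n : ℝ) * θ₀ - (k : ℝ) * (2 * Real.pi), (abs_lt.1 hk |> fun p => ?_), ?_⟩
  · have h1' : a / h ≤ ((⌈a / h⌉ : ℤ) : ℝ) := Int.le_ceil _
    have h2 : a ≤ ((⌈a / h⌉ : ℤ) : ℝ) * h := by rwa [div_le_iff₀ hh] at h1'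
    have h3 : ((⌈a / h⌉ : ℤ) : ℝ) ≤ (n : ℝ) := by exact_mod_cast hmn
    nlinarith
  · have h1' : ((⌈a / h⌉ : ℤ) : ℝ) < a / h + 1 := Int.ceil_lt_add_one _
    have h2 : ((⌈a / h⌉ : ℤ) : ℝ) * h < (a / h + 1) * h := mul_lt_mul_of_pos_right h1' hh
    have h2' : (a / h + 1) * h = a + h := by field_simp
    have h3 : (n : ℝ) < ((⌈a / h⌉ : ℤ) : ℝ) + N := by exact_mod_cast hnm
    nlinarith
  · rw [abs_le]; constructor <;> linarith [p.1, p.2]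
  · intro t ht x
    have hper : ∀ y : E3, rotZ ((n : ℝ) * θ₀ - (k : ℝ) * (2 * Real.pi)) y = rotZ ((n : ℝ) * θ₀) y := by
      intro y
      rw [← rotZ_add_int_mul_two_pi ((n : ℝ) * θ₀ - (k : ℝ) * (2 * Real.pi)) k y]
      congr 1; ring
    rw [hper, hper, isScrewEquivariant_zmul hS n t ht x, sub_self, norm_zero]
    exact div_nonneg hδ.le (Real.sqrt_nonneg _)

/-- The irrational screw (any drift `h ≠ 0`) is axially recurrent: negative drift via the inverse screw. -/
theorem isAxiallyRecurrent_of_screw (h1 : SyndeticReturn) {u : ℝ → E3 → E3} {θ₀ h : ℝ}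
    (hθ : Irrational (θ₀ / (2 * Real.pi))) (hh : h ≠ 0) (hS : IsScrewEquivariant θ₀ h u) :
    IsAxiallyRecurrent u := by
  rcases lt_or_gt_of_ne hh with hneg | hpos
  · have hθ' : Irrational (-θ₀ / (2 * Real.pi)) := by rw [neg_div]; exact hθ.neg
    exact isAxiallyRecurrent_of_screw_pos h1 hθ' (neg_pos.2 hneg) (isScrewEquivariant_inv hS)
  · exact isAxiallyRecurrent_of_screw_pos h1 hθ hpos hS

/-- The recurrence cell reduces to the SAME research residual S3. -/
theorem row_ArecT_of_vanishingBlowdownLiouville (h3 : VanishingBlowdownLiouville) : Row_ArecT :=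
  fun C u hu hR => h3 C u hu (hasVanishingBlowdown_of_axiallyRecurrent hu hR)

/-- The screw cell is a sub-cell of the recurrence cell (S1 proved). -/
theorem row_A13isqT_of_row_ArecT (h : Row_ArecT) : Row_A13isqT :=
  fun C u _ _ hu hθ hh hS => h C u hu (isAxiallyRecurrent_of_screw stub_syndeticReturn hθ hh hS)

/-- BRIDGE BY NAME: (L′) ⇒ the recurrence row (the converse must FAIL: the row is a strict sub-cell). -/
theorem row_ArecT_of_typeIAncientLiouville
    (hL : Summit.NavierStokesRegularity.NavierStokesRegularity.Theses.SymmetryModuliCount.TypeIAncientLiouville) :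
    Row_ArecT :=
  fun C u hu _ => hL C u (isTypeIAncientMild_iff.1 hu)

end Summit.NavierStokesRegularity.NavierStokesRegularity.Theorems.ScenarioCensus.ScrewBlowdown
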